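import Literature.Analysis.UnboundedOperators.StrongContRepresentationDerivProofs
import Literature.Analysis.UnboundedOperators.StrongContRepresentationDensityProofs
import Mathlib.Analysis.InnerProductSpace.Calculus
import Mathlib.Analysis.Calculus.Deriv.MeanValue
import Mathlib.Analysis.SpecialFunctions.ExpDeriv
import HarnessLib

/-!
# Growth bound of a C₀-semigroup from the numerical range of its generator (energy method):
  `Re⟪Ax, x⟫ ≤ ω‖x‖²` on `D(A)` ⇒ `‖T(t)‖ ≤ e^{ωt}` (Engel–Nagel II Cor. 3.6 / Thm. 3.15, Hilbert space)

Analysis/UnboundedOperators proofs-layer file (theorems only, no definitions, no named facts), for the tree's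
`C0Semigroup ℂ H` on a complex Hilbert space. The ENERGY METHOD: for `x ∈ D(A)` the orbit `u(t) = T(t)x` is
differentiable with `u' = T(t)Ax = A u(t)` (`C0Semigroup.hasDerivAt_app_of_mem`, `generator_app_comm`), so
`d/dt ‖u‖² = 2Re⟪Au, u⟫ ≤ 2ω‖u‖²`, whence `e^{−2ωt}‖u(t)‖²` is non-increasing and `‖T(t)x‖ ≤ e^{ωt}‖x‖` on the
dense `D(A)` (`dense_generator_domain_of_normedSpace_real`), hence everywhere:

* `C0Semigroup.norm_app_apply_le_of_re_inner_le` — `‖T(t)x‖ ≤ e^{ωt}‖x‖` for `x ∈ D(A)`;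
* **`C0Semigroup.norm_app_le_of_re_inner_le`** — `‖T(t)‖ ≤ e^{ωt}`;
* `C0Semigroup.isContraction_of_re_inner_nonpos` — `Re⟪Ax, x⟫ ≤ 0` ⇒ contraction semigroup.

(So the range condition of the Lumer–Phillips theorem — `LumerPhillipsQuasi.lean` — is automatic for a
GENERATOR with this numerical-range bound; cf. `LumerPhillipsCharacterisation.lean`.)

## References

* K.-J. Engel, R. Nagel, *One-Parameter Semigroups for Linear Evolution Equations* (2000), Ch. II
  Lemma 1.3, Cor. 3.6, Thm. 3.15. [EngelNagel2000]
-/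

noncomputable section

open Set Filter
open scoped Topology NNReal InnerProductSpace

namespace Literature.Analysis.UnboundedOperators

namespace C0Semigroup

variable {H : Type*} [NormedAddCommGroup H] [InnerProductSpace ℂ H] [CompleteSpace H]

omit [CompleteSpace H] in
/-- `‖x‖² = Re⟪x, x⟫` (real part as `Complex.re`). [folklore] -/
private theorem norm_sq_eq_re_inner' (x : H) : ‖x‖ ^ 2 = (⟪x, x⟫_ℂ).re := by
  have := inner_self_eq_norm_sq (𝕜 := ℂ) x
  rw [RCLike.re_to_complex] at this
  exact this.symm

/-- **Energy estimate on `D(A)`**: if `Re⟪Ax, x⟫ ≤ ω‖x‖²` on `D(A)` then `‖T(t)x‖ ≤ e^{ωt}‖x‖` for `x ∈ D(A)`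
(`t ↦ e^{−2ωt}‖T(t)x‖²` is non-increasing since its derivative is `e^{−2ωt}(2Re⟪AT(t)x, T(t)x⟫ − 2ω‖T(t)x‖²) ≤ 0`).
[cite: EngelNagel2000, Ch. II Cor. 3.6] -/
theorem norm_app_apply_le_of_re_inner_le (T : C0Semigroup ℂ H) {ω : ℝ}
    (hre : ∀ x : T.generator.domain, (⟪(T.generator x : H), (x : H)⟫_ℂ).re ≤ ω * ‖(x : H)‖ ^ 2)
    (x : T.generator.domain) (t : ℝ≥0) : ‖T.app t (x : H)‖ ≤ Real.exp (ω * t) * ‖(x : H)‖ := by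
  -- the orbit and the energy
  set u : ℝ → H := fun s => T.app s.toNNReal (x : H) with hu
  set φ : ℝ → ℝ := fun s => Real.exp (-(2 * ω) * s) * ‖u s‖ ^ 2 with hφ
  -- continuity of the orbit
  have hu_cont : Continuous u := (T.continuous_app (x : H)).comp continuous_real_toNNReal
  have hφ_cont : Continuous φ := by
    simp only [hφ]
    fun_prop
  -- derivative of the orbit at `s > 0`: `u' = T(s) A x`
  have hu_deriv : ∀ s : ℝ, 0 < s → HasDerivAt u (T.app s.toNNReal (T.generator x)) s := by
    intro s hs
    have h := T.hasDerivAt_app_of_mem x (t := s.toNNReal) (Real.toNNReal_pos.2 hs)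
    rwa [Real.coe_toNNReal s hs.le] at h
  -- derivative of `‖u‖²` at `s > 0` and its bound
  have hg_deriv : ∀ s : ℝ, 0 < s → HasDerivAt (fun r => ‖u r‖ ^ 2)
      ((⟪u s, T.app s.toNNReal (T.generator x)⟫_ℂ + ⟪T.app s.toNNReal (T.generator x), u s⟫_ℂ).re) s := by
    intro s hs
    have h1 := (hu_deriv s hs).inner ℂ (hu_deriv s hs)
    have h2 := (Complex.reCLM.hasFDerivAt).comp_hasDerivAt s h1
    have hfun : (fun r => ‖u r‖ ^ 2) = (Complex.reCLM : ℂ → ℝ) ∘ fun r => ⟪u r, u r⟫_ℂ := by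
      funext r; simp only [Function.comp_apply, Complex.reCLM_apply]; exact norm_sq_eq_re_inner' (u r)
    rw [hfun]
    simpa only [Complex.reCLM_apply] using h2
  have hg_bound : ∀ s : ℝ, 0 < s →
      (⟪u s, T.app s.toNNReal (T.generator x)⟫_ℂ + ⟪T.app s.toNNReal (T.generator x), u s⟫_ℂ).re ≤
        2 * ω * ‖u s‖ ^ 2 := by
    intro s hs
    -- `T(s) A x = A (T(s) x)` with `T(s) x ∈ D(A)`
    have hmem : u s ∈ T.generator.domain := T.app_mem_generator_domain x.2 _
    have hcomm : T.app s.toNNReal (T.generator x) = T.generator ⟨u s, hmem⟩ :=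
      (T.generator_app_comm x s.toNNReal).symm
    rw [hcomm, Complex.add_re, ← inner_conj_symm (u s), Complex.conj_re]
    have := hre ⟨u s, hmem⟩
    simp only at this
    linarith
  -- derivative of `φ` at `s > 0` is `≤ 0`
  have hφ_deriv : ∀ s : ℝ, 0 < s → HasDerivAt φ
      (Real.exp (-(2 * ω) * s) * (-(2 * ω)) * ‖u s‖ ^ 2 + Real.exp (-(2 * ω) * s) *
        (⟪u s, T.app s.toNNReal (T.generator x)⟫_ℂ + ⟪T.app s.toNNReal (T.generator x), u s⟫_ℂ).re) s := by
    intro s hs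
    have he : HasDerivAt (fun r => Real.exp (-(2 * ω) * r)) (Real.exp (-(2 * ω) * s) * (-(2 * ω))) s := by
      have := ((hasDerivAt_id s).const_mul (-(2 * ω))).exp
      simpa using this
    exact he.mul (hg_deriv s hs)
  have hanti : AntitoneOn φ (Ici 0) := by
    refine antitoneOn_of_hasDerivWithinAt_nonpos (convex_Ici 0) hφ_cont.continuousOn
      (f' := fun s => Real.exp (-(2 * ω) * s) * (-(2 * ω)) * ‖u s‖ ^ 2 + Real.exp (-(2 * ω) * s) *
        (⟪u s, T.app s.toNNReal (T.generator x)⟫_ℂ + ⟪T.app s.toNNReal (T.generator x), u s⟫_ℂ).re) ?_ ?_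
    · intro s hs
      rw [interior_Ici] at hs ⊢
      exact (hφ_deriv s hs).hasDerivWithinAt
    · intro s hs
      rw [interior_Ici] at hs
      have hb := hg_bound s hs
      have hex : 0 < Real.exp (-(2 * ω) * s) := Real.exp_pos _
      nlinarith [hb, hex, sq_nonneg ‖u s‖]
  -- compare `φ t ≤ φ 0 = ‖x‖²`
  have h0 : φ 0 = ‖(x : H)‖ ^ 2 := by
    simp only [hφ, hu, mul_zero, Real.exp_zero, one_mul, Real.toNNReal_zero, app_zero, one_apply_eq_self]
  have ht : φ t ≤ ‖(x : H)‖ ^ 2 := by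
    rw [← h0]; exact hanti Set.self_mem_Ici (show (t : ℝ) ∈ Ici (0 : ℝ) from t.coe_nonneg) t.coe_nonneg
  have hut : u t = T.app t (x : H) := by simp only [hu, Real.toNNReal_coe]
  simp only [hφ, hut] at ht
  -- `e^{−2ωt}‖T(t)x‖² ≤ ‖x‖²` ⇒ `‖T(t)x‖ ≤ e^{ωt}‖x‖`
  have hexp : Real.exp (ω * t) ^ 2 * Real.exp (-(2 * ω) * t) = 1 := by
    rw [← Real.exp_nat_mul, ← Real.exp_add]; norm_num; ring_nf
  have hsq : ‖T.app t (x : H)‖ ^ 2 ≤ (Real.exp (ω * t) * ‖(x : H)‖) ^ 2 := by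
    have hex : 0 < Real.exp (ω * t) ^ 2 := by positivity
    calc ‖T.app t (x : H)‖ ^ 2 = Real.exp (ω * t) ^ 2 * (Real.exp (-(2 * ω) * t) * ‖T.app t (x : H)‖ ^ 2) := by
          rw [← mul_assoc, hexp, one_mul]
      _ ≤ Real.exp (ω * t) ^ 2 * ‖(x : H)‖ ^ 2 := mul_le_mul_of_nonneg_left ht hex.le
      _ = (Real.exp (ω * t) * ‖(x : H)‖) ^ 2 := by ring
  exact (pow_le_pow_iff_left₀ (norm_nonneg _) (by positivity) two_ne_zero).1 hsq

/-- **GROWTH BOUND FROM THE NUMERICAL RANGE (energy method, Engel–Nagel II Cor. 3.6).** If the generator of a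
C₀-semigroup on a complex Hilbert space satisfies `Re⟪Ax, x⟫ ≤ ω‖x‖²` on `D(A)`, then `‖T(t)‖ ≤ e^{ωt}` for all
`t ≥ 0` (the estimate on the dense `D(A)` extends by continuity). [cite: EngelNagel2000, Ch. II Cor. 3.6] -/
theorem norm_app_le_of_re_inner_le (T : C0Semigroup ℂ H) {ω : ℝ}
    (hre : ∀ x : T.generator.domain, (⟪(T.generator x : H), (x : H)⟫_ℂ).re ≤ ω * ‖(x : H)‖ ^ 2) (t : ℝ≥0) :
    ‖T.app t‖ ≤ Real.exp (ω * t) := by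
  refine ContinuousLinearMap.opNorm_le_bound _ (Real.exp_pos _).le fun y => ?_
  -- the set where the estimate holds is closed and contains the dense `D(A)`
  have hS : IsClosed {y : H | ‖T.app t y‖ ≤ Real.exp (ω * t) * ‖y‖} :=
    isClosed_le ((T.app t).continuous.norm) (continuous_const.mul continuous_norm)
  have hD : (T.generator.domain : Set H) ⊆ {y : H | ‖T.app t y‖ ≤ Real.exp (ω * t) * ‖y‖} :=
    fun y hy => T.norm_app_apply_le_of_re_inner_le hre ⟨y, hy⟩ t
  have huniv : (Set.univ : Set H) ⊆ {y : H | ‖T.app t y‖ ≤ Real.exp (ω * t) * ‖y‖} := by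
    rw [← T.dense_generator_domain_of_normedSpace_real.closure_eq]
    exact hS.closure_subset_iff.2 hD
  exact huniv (Set.mem_univ y)

/-- **Dissipative generator ⇒ contraction semigroup** (Hilbert space): `Re⟪Ax, x⟫ ≤ 0` on `D(A)` ⇒ `‖T(t)‖ ≤ 1`.
[cite: EngelNagel2000, Ch. II Thm. 3.15] -/
theorem isContraction_of_re_inner_nonpos (T : C0Semigroup ℂ H)
    (hre : ∀ x : T.generator.domain, (⟪(T.generator x : H), (x : H)⟫_ℂ).re ≤ 0) : T.IsContraction := by
  intro t
  have h := T.norm_app_le_of_re_inner_le (ω := 0) (fun x => by rw [zero_mul]; exact hre x) t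
  simpa using h

end C0Semigroup

end Literature.Analysis.UnboundedOperators
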